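import Summits.BirchSwinnertonDyer.BirchSwinnertonDyer.Theorems.AlignedTransportAtTwoMainConjectureTransportAlignedAtTwoOrdPlusLineTools
import Summits.BirchSwinnertonDyer.BirchSwinnertonDyer.Theorems.AlignedTransportAtTwoMainConjectureTransportAlignedAtTwoTwoCurvePlusLine
import Summits.BirchSwinnertonDyer.BirchSwinnertonDyer.Theorems.ByReductionTypeAtTwoAnalyticMuZeroAtTwoHolds
import Literature.NumberTheory.EllipticCurves.ModPReducibilityAlmostAllProofs
import HarnessLib

/-!
# Crux C1 `MainConjectureTransportAlignedAtTwo` (stmt-BirchSwinnertonDyer-22296), line `birth`, plan «ord-plusline» step (N):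
# THE DEPLETED PERIOD FUNCTIONAL OF AN ORDINARY `S₃`-CURVE TAKES AN ODD VALUE ON `H₁(X₀(L); ℤ)` (lead att-p1 g9; `--supports 22296`)

THEOREMS ONLY (no `def`, no `sorry`, no named fact). BSD is not proved by this; C1 is not closed by this.

For `W` good ordinary at `2` without rational `2`-torsion abscissa, its newform `f`, a duplicate-free list `l` of odd places (`S = {ℓ_v}`,
`D = ∏ ℓ²`), an odd level `L` with `N·∏ℓ² ∣ L`, the `S`-depleted form `g ∈ S₂(Γ₀(L))` (an eigenvector of `T_q`, `q ∤ L`, with eigenvalue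
`a_q(W)`), and an even-branch lift `G`: the integer-valued functional `n(x) = (2D/Ω⁺_f)·re x(g)` on `Λ = periodHomology L`
(`…OrdPlusLineTools.exists_int_depleted_periodFunctional`) takes an ODD value at some `{∞, γ∞}` (`exists_odd_depleted_periodFunctional`).
MECHANISM: `μ(G) = 0` is a THEOREM (`AnalyticMuTwo`), the depletion factor has unit content, so `red((∏𝒫^ι)·G) ≠ 0` and some depleted table value
`Ψ(m/2ᵏ)` is not `2`-integral (`exists_depleted_table_norm_gt_one`); `m/2ᵏ = γ·0` and the period formula (`…DepletedPeriodFormula`) give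
`n(γ) = 2D(Ψ(m/2ᵏ) − Ψ(0))`; if `Ψ(0)` is `2`-integral, `n(γ)` is odd; otherwise the `T_q`-transport of the cusp `0` at a good prime `q ∤ L` with
`a_q(W) − q − 1` odd (`exists_prime_notMem_not_dvd_frobeniusTrace_sub`, Darmon–Diamond–Taylor Prop. 2.6 (b)) writes the odd number
`(a_q − q − 1)·2D·Ψ(0)` as `Σⱼ n(γⱼ)`, so some `n(γⱼ)` is odd. §1 records the `2`-adic bookkeeping on integers and rationals used.

References: Mazur–Tate–Teitelbaum 1986 §I.10 [MazurTateTeitelbaum1986Invent]; Darmon–Diamond–Taylor 1995 Prop. 2.6 (b) [DarmonDiamondTaylor1995];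
Cremona 1997 §2.8 [CremonaAlgorithms1997]; Greenberg–Vatsal 2000 §1 (8)–(10) [GreenbergVatsal2000].
-/

noncomputable section

-- justification: the `Summit.BirchSwinnertonDyer.BirchSwinnertonDyer.…` path repeats a component (route-file convention)
set_option linter.dupNamespace false

open scoped MatrixGroups ModularForm NumberField Classical
open CongruenceSubgroup Complex WeierstrassCurve IsDedekindDomain PowerSeries
open Literature.NumberTheory.EllipticCurves Literature.NumberTheory.EllipticCurves.ModularForms
open Literature.NumberTheory.EllipticCurves.Greenberg1999 Literature.NumberTheory.EllipticCurves.GreenbergVatsal2000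
open Summit.BirchSwinnertonDyer.Rank1Residual.F1Sign2 Summit.BirchSwinnertonDyer.Rank1Residual.X1.MuLambda
open Summit.BirchSwinnertonDyer.BirchSwinnertonDyer.Theorems.AlignedTransportAtTwoSigmaGlue
open Summit.BirchSwinnertonDyer.BirchSwinnertonDyer.Theorems.AlignedTransportAtTwoClosure
open Summit.BirchSwinnertonDyer.BirchSwinnertonDyer.Theorems.AlignedTransportAtTwoSigmaRaw
open Summit.BirchSwinnertonDyer.BirchSwinnertonDyer.Theorems.SignedTransportAtTwo
open Summit.BirchSwinnertonDyer.BirchSwinnertonDyer.Theorems.AlignedTransportAtTwoDepletedPeriodFormula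
open Summit.BirchSwinnertonDyer.BirchSwinnertonDyer.Theorems.AlignedTransportAtTwoOrdPlusLineTools
open Summit.BirchSwinnertonDyer.BirchSwinnertonDyer.Theorems.AlignedTransportAtTwoTwoCurvePlusLine

namespace Summit.BirchSwinnertonDyer.BirchSwinnertonDyer.Theorems.AlignedTransportAtTwoOrdPlusLineOdd

/-! ## §1 `2`-adic bookkeeping on integers and rationals -/

/-- An integer of `2`-adic norm `> 1/2` is odd. [folklore] -/
theorem odd_of_half_lt_norm {z : ℤ} (h : (2 : ℝ)⁻¹ < ‖(z : ℚ_[2])‖) : Odd z := by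
  rw [← Int.not_even_iff_odd]
  rintro ⟨k, rfl⟩
  have h2 : (2 ^ 1 : ℤ) ∣ k + k := ⟨k, by ring⟩
  have hle := (Padic.norm_int_le_pow_iff_dvd (p := 2) (k + k) 1).mpr h2
  have : ((2 : ℕ) : ℝ) ^ (-(1 : ℕ) : ℤ) = 2⁻¹ := by norm_num
  rw [this] at hle
  exact (not_lt.mpr hle) h

/-- An even integer has `2`-adic norm `≤ 1/2`. [folklore] -/
theorem norm_le_half_of_even {z : ℤ} (h : Even z) : ‖(z : ℚ_[2])‖ ≤ 2⁻¹ := by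
  obtain ⟨k, rfl⟩ := h
  have h2 : (2 ^ 1 : ℤ) ∣ k + k := ⟨k, by ring⟩
  have hle := (Padic.norm_int_le_pow_iff_dvd (p := 2) (k + k) 1).mpr h2
  have : ((2 : ℕ) : ℝ) ^ (-(1 : ℕ) : ℤ) = 2⁻¹ := by norm_num
  rwa [this] at hle

/-- `‖D‖₂ = 1` for a product of squares of odd primes. [folklore] -/
theorem norm_prod_sq_eq_one (S : Finset ℕ) (hS : ∀ ℓ ∈ S, ℓ.Prime) (hS2 : ∀ ℓ ∈ S, ℓ ≠ 2) :
    ‖(((∏ ℓ ∈ S, ℓ ^ 2 : ℕ)) : ℚ_[2])‖ = 1 := by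
  rw [Padic.norm_natCast_eq_one_iff]
  exact Nat.Coprime.prod_right fun ℓ hℓ ↦ Nat.Coprime.pow_right 2 ((Nat.coprime_primes Nat.prime_two (hS ℓ hℓ)).mpr (hS2 ℓ hℓ).symm)

/-- `‖2·D·x‖₂ = ‖x‖₂/2` for `D` a product of squares of odd primes. [folklore] -/
theorem norm_two_mul_prod_sq_mul (S : Finset ℕ) (hS : ∀ ℓ ∈ S, ℓ.Prime) (hS2 : ∀ ℓ ∈ S, ℓ ≠ 2) (x : ℚ) :
    ‖((2 * ((∏ ℓ ∈ S, ℓ ^ 2 : ℕ) : ℚ) * x : ℚ) : ℚ_[2])‖ = 2⁻¹ * ‖((x : ℚ) : ℚ_[2])‖ := by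
  push_cast [Rat.cast_mul]
  -- `‖2‖₂ = 1/2` (`Rank2Observatory.padic_norm_two`, not imported here)
  have h2 : ‖(2 : ℚ_[2])‖ = 2⁻¹ := by simpa using Padic.norm_p (p := 2)
  rw [norm_mul, norm_mul, h2]
  have h := norm_prod_sq_eq_one S hS hS2
  push_cast at h
  rw [h, mul_one]

/-! ## §2 The odd value -/

section Odd

variable (W : WeierstrassCurve ℚ) [W.IsElliptic] [W.IsGloballyMinimal] [NeZero (W.conductorNorm ℤ)]
  {f : CuspForm (Gamma0 (W.conductorNorm ℤ)) 2}

/-- **Real form of the period formula**: `re {∞, r}_g = Ω⁺_f · Ψ(r)`, `Ψ = eulerDepleteTableList W l [·]⁺_f`. [cite: EmertonPollackWeston2006, §3 (3.4)–(3.5)] -/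
theorem re_modularSymbol_depleted_eq_real (hf : IsNewformOf W f) (l : List (HeightOneSpectrum (𝓞 ℚ))) (hl : l.Nodup)
    (L : ℕ) [NeZero L]
    (hNL : W.conductorNorm ℤ * ∏ ℓ ∈ (l.map Rat.HeightOneSpectrum.natGenerator).toFinset, ℓ ^ 2 ∣ L)
    (g : CuspForm (Gamma0 L) 2)
    (hg : ∀ n : ℕ, cuspCoeff g n =
      if ∃ ℓ ∈ (l.map Rat.HeightOneSpectrum.natGenerator).toFinset, ℓ ∣ n then 0 else cuspCoeff f n)
    (r : ℚ) :
    (modularSymbol g r).re = plusPeriod f * ((eulerDepleteTableList W l (ratPlusSymbol f) r : ℚ) : ℝ) := by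
  have h := re_modularSymbol_depleted_eq hf l hl L hNL g hg r
  apply Complex.ofReal_injective
  rw [h, Complex.ofReal_mul, Complex.ofReal_ratCast]

/-- **`n(γ) = 2D·(Ψ(r) − Ψ(0))` when `r = γ·0`**: the integer value of the depleted period functional at `{∞, γ∞}` in terms of the depleted table.
[cite: Manin1972, Prop. 1.4 and Thm. 1.6] -/
theorem intCast_eq_depleted_sub (hf : IsNewformOf W f) (l : List (HeightOneSpectrum (𝓞 ℚ))) (hl : l.Nodup)
    (L : ℕ) [NeZero L]
    (hNL : W.conductorNorm ℤ * ∏ ℓ ∈ (l.map Rat.HeightOneSpectrum.natGenerator).toFinset, ℓ ^ 2 ∣ L)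
    (g : CuspForm (Gamma0 L) 2)
    (hg : ∀ n : ℕ, cuspCoeff g n =
      if ∃ ℓ ∈ (l.map Rat.HeightOneSpectrum.natGenerator).toFinset, ℓ ∣ n then 0 else cuspCoeff f n)
    {r : ℚ} {γ : Gamma0 L} (hγ : ∀ h : CuspForm (Gamma0 L) 2, modularSymbol h r = cuspSymbol h γ + modularSymbol h 0)
    {z : ℤ} (hz : (2 * ((∏ ℓ ∈ (l.map Rat.HeightOneSpectrum.natGenerator).toFinset, ℓ ^ 2 : ℕ) : ℝ) / plusPeriod f) *
      (periodFunctional L γ g).re = z) :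
    (z : ℚ) = 2 * ((∏ ℓ ∈ (l.map Rat.HeightOneSpectrum.natGenerator).toFinset, ℓ ^ 2 : ℕ) : ℚ) *
      (eulerDepleteTableList W l (ratPlusSymbol f) r - eulerDepleteTableList W l (ratPlusSymbol f) 0) := by
  have hΩ : 0 < plusPeriod f := IsNewform0.plusPeriod_pos_holds hf.1 hf.coeffField_eq_bot
  have h2 : (modularSymbol g r).re = (cuspSymbol g γ).re + (modularSymbol g 0).re := by rw [hγ g, Complex.add_re]
  rw [re_modularSymbol_depleted_eq_real W hf l hl L hNL g hg r, re_modularSymbol_depleted_eq_real W hf l hl L hNL g hg 0] at h2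
  rw [periodFunctional_apply] at hz
  have hre : (cuspSymbol g γ).re = plusPeriod f * (((eulerDepleteTableList W l (ratPlusSymbol f) r : ℚ) : ℝ) -
      ((eulerDepleteTableList W l (ratPlusSymbol f) 0 : ℚ) : ℝ)) := by linear_combination (-1 : ℝ) * h2
  have hzR : (z : ℝ) = 2 * ((∏ ℓ ∈ (l.map Rat.HeightOneSpectrum.natGenerator).toFinset, ℓ ^ 2 : ℕ) : ℝ) *
      (((eulerDepleteTableList W l (ratPlusSymbol f) r : ℚ) : ℝ) - ((eulerDepleteTableList W l (ratPlusSymbol f) 0 : ℚ) : ℝ)) := by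
    rw [← hz, hre]; field_simp
  exact_mod_cast hzR

/-- **The depleted period functional of an ordinary `S₃`-curve takes an ODD value on `H₁(X₀(L); ℤ)`.** See the module docstring for the mechanism
(`μ = 0` theorem ⇒ non-integral depleted table value ⇒ `γ·0` ⇒ period formula; `T_q`-transport of the cusp `0` if needed).
[cite: MazurTateTeitelbaum1986Invent, §I.10 (10.1)] [cite: DarmonDiamondTaylor1995, Prop. 2.6 (b)] [cite: CremonaAlgorithms1997, §2.8 (2.8.8)] -/
theorem exists_odd_depleted_periodFunctional (hord : IsOrdinaryAt W 2) (ht : ∀ x : ℚ, ¬ HasRationalTwoTorsionX W x) (hf : IsNewformOf W f)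
    (l : List (HeightOneSpectrum (𝓞 ℚ))) (hl : l.Nodup) (hl2 : ∀ v ∈ l, Rat.HeightOneSpectrum.natGenerator v ≠ 2)
    (L : ℕ) [NeZero L] (hL : Odd L)
    (hNL : W.conductorNorm ℤ * ∏ ℓ ∈ (l.map Rat.HeightOneSpectrum.natGenerator).toFinset, ℓ ^ 2 ∣ L)
    (g : CuspForm (Gamma0 L) 2)
    (hg : ∀ n : ℕ, cuspCoeff g n =
      if ∃ ℓ ∈ (l.map Rat.HeightOneSpectrum.natGenerator).toFinset, ℓ ∣ n then 0 else cuspCoeff f n)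
    (hTg : ∀ (q : ℕ) (hq : q.Prime), ¬ q ∣ L → (haveI : NeZero q := ⟨hq.ne_zero⟩; heckeT (Gamma0 L) 2 q g) = ((W.LFunction q : ℤ) : ℂ) • g)
    {G : IwasawaAlgebra 2} (hG : IsEvenBranchLiftAtTwo W f G) :
    ∃ γ : Gamma0 L, ∃ z : ℤ,
      (2 * ((∏ ℓ ∈ (l.map Rat.HeightOneSpectrum.natGenerator).toFinset, ℓ ^ 2 : ℕ) : ℝ) / plusPeriod f) *
        (periodFunctional L γ g).re = z ∧ Odd z := by
  set SS := (l.map Rat.HeightOneSpectrum.natGenerator).toFinset with hSSdef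
  have hSSp : ∀ ℓ ∈ SS, ℓ.Prime := by
    intro ℓ hℓ; rw [hSSdef, List.mem_toFinset, List.mem_map] at hℓ
    obtain ⟨w, -, rfl⟩ := hℓ; exact Rat.HeightOneSpectrum.prime_natGenerator w
  have hSS2 : ∀ ℓ ∈ SS, ℓ ≠ 2 := by
    intro ℓ hℓ; rw [hSSdef, List.mem_toFinset, List.mem_map] at hℓ
    obtain ⟨w, hw, rfl⟩ := hℓ; exact hl2 w hw
  have h2D := norm_two_mul_prod_sq_mul SS hSSp hSS2
  have hirr := irr_two_of_forall_not_hasRationalTwoTorsionX W ht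
  -- integrality on `Λ`
  have hint := exists_int_depleted_periodFunctional W hf SS hSSp L hNL g (fun n ↦ by rw [hg n]; split_ifs <;> rfl)
  -- `red ((∏𝒫)·G) ≠ 0`
  have hredG : red G ≠ 0 :=
    Summit.BirchSwinnertonDyer.BirchSwinnertonDyer.Theorems.AnalyticMuTwo.red_ne_zero_of_isEvenBranchLiftAtTwo_of_forall_not_hasRationalTwoTorsionX
      W hord ht f hf G hG
  have hredP : red ((l.map (eulerFactorElementInv W 2)).prod * G) ≠ 0 := by
    have hunit : HasUnitContent (l.map (eulerFactorElementInv W 2)).prod := by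
      have h := (order_map_toZMod_eulerFactorProductInv_two W (S₀ := l.toFinset) (fun v hv ↦ hl2 v (List.mem_toFinset.mp hv))).1
      rwa [eulerFactorProductInv_eq_prod, List.prod_toFinset _ hl] at h
    rw [red_mul]
    exact mul_ne_zero (red_ne_zero_of_hasUnitContent hunit) hredG
  obtain ⟨m, k, hmk⟩ := exists_depleted_table_norm_gt_one W hord ht hf l hl2 hG hredP
  -- `r = m/2ᵏ = γ·0`
  obtain ⟨γ, hγ⟩ := exists_gamma0_modularSymbol_eq_of_coprime_den (N' := L) (coprime_den_twoPow hL m k)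
  obtain ⟨z, hz⟩ := hint _ (periodFunctional_mem_periodHomology L γ)
  have hzq := intCast_eq_depleted_sub W hf l hl L hNL g hg hγ hz
  -- bounds: `‖Ψ(0)‖ ≤ 2`
  have hreal : ∀ n, (cuspCoeff f n).im = 0 := cuspCoeff_im_eq_zero_of_coeffField_eq_bot hf.coeffField_eq_bot
  obtain ⟨n₁, h2n₁, h01⟩ := exists_intCast_mul_modularSymbol_zero_mem (p := 2) not_irreducible_of_frobeniusTrace_congr_holds hf hirr
  have hpN : ¬ 2 ∣ W.conductorNorm ℤ := not_dvd_level_of_isNewformOf hf hord.1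
  have hsym : ∀ m k : ℕ, ‖((ratPlusSymbol f ((m : ℚ) / ((2 : ℕ) : ℚ) ^ k) : ℚ) : ℚ_[2])‖ ≤ 2 := fun m k ↦
    norm_ratPlusSymbol_two_le_two f hreal h2n₁ h01 (coprime_den_div_prime_pow hpN m k)
  have hΨ0 : ‖((eulerDepleteTableList W l (ratPlusSymbol f) 0 : ℚ) : ℚ_[2])‖ ≤ 2 := by
    have h := norm_eulerDepleteTableList_le W (p := 2) l hl2 (φ := ratPlusSymbol f) zero_le_two hsym 0 0
    rwa [Nat.cast_zero, zero_div] at h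
  -- `‖2D·Ψ(r)‖ > 1/2`
  have hbig : (2 : ℝ)⁻¹ < ‖((2 * ((∏ ℓ ∈ SS, ℓ ^ 2 : ℕ) : ℚ) *
      eulerDepleteTableList W l (ratPlusSymbol f) ((m : ℚ) / (2 : ℚ) ^ k) : ℚ) : ℚ_[2])‖ := by
    rw [h2D]
    linarith [hmk]
  by_cases hcase : ‖((eulerDepleteTableList W l (ratPlusSymbol f) 0 : ℚ) : ℚ_[2])‖ ≤ 1
  · -- `Ψ(0)` is `2`-integral: `z` itself is odd
    refine ⟨γ, z, hz, odd_of_half_lt_norm ?_⟩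
    have hsmall : ‖((2 * ((∏ ℓ ∈ SS, ℓ ^ 2 : ℕ) : ℚ) * eulerDepleteTableList W l (ratPlusSymbol f) 0 : ℚ) : ℚ_[2])‖ ≤ 2⁻¹ := by
      rw [h2D]
      linarith [hcase]
    have hzsplit : (z : ℚ_[2]) =
        ((2 * ((∏ ℓ ∈ SS, ℓ ^ 2 : ℕ) : ℚ) * eulerDepleteTableList W l (ratPlusSymbol f) ((m : ℚ) / (2 : ℚ) ^ k) : ℚ) : ℚ_[2]) +
        -(((2 * ((∏ ℓ ∈ SS, ℓ ^ 2 : ℕ) : ℚ) * eulerDepleteTableList W l (ratPlusSymbol f) 0 : ℚ) : ℚ_[2])) := by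
      have hcast : (z : ℚ_[2]) = ((z : ℚ) : ℚ_[2]) := by norm_cast
      rw [hcast, hzq]; push_cast; ring
    rw [hzsplit]
    by_contra hle
    push Not at hle
    have heq := Padic.norm_eq_of_norm_add_lt_left (lt_of_le_of_lt hle hbig)
    rw [norm_neg] at heq
    rw [heq] at hbig
    exact (not_lt.mpr hsmall) hbig
  · -- `Ψ(0)` is a genuine half-integer: transport the cusp `0` by `T_q`
    push Not at hcase
    obtain ⟨q, hq, hqS, -, hgoodq, hodd⟩ :=
      exists_prime_notMem_not_dvd_frobeniusTrace_sub W 2 hirr (L.primeFactors : Set ℕ) (Finset.finite_toSet _)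
    have hqL : ¬ q ∣ L := fun h ↦ hqS (Finset.mem_coe.mpr (Nat.mem_primeFactors.mpr ⟨hq.out, h, NeZero.ne L⟩))
    obtain ⟨γs, hγs⟩ := exists_heckeT_transport_zero (N' := L) hq.out hqL
    obtain ⟨u, hu⟩ : ∃ u : ℤ, u = W.LFunction q - q - 1 := ⟨_, rfl⟩
    have hrel : (u : ℂ) * modularSymbol g 0 = ∑ j, cuspSymbol g (γs j) := by
      rw [← hγs g _ (hTg q hq.out hqL), hu]; push_cast; ring
    -- the integers `n(γⱼ)`
    choose zs hzs using fun j : Fin q ↦ hint _ (periodFunctional_mem_periodHomology L (γs j))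
    have hΩ : 0 < plusPeriod f := IsNewform0.plusPeriod_pos_holds hf.1 hf.coeffField_eq_bot
    -- `u·2D·Ψ(0) = Σ zs j`
    have hre : (u : ℝ) * (plusPeriod f * ((eulerDepleteTableList W l (ratPlusSymbol f) 0 : ℚ) : ℝ)) =
        ∑ j, (cuspSymbol g (γs j)).re := by
      have h := congrArg Complex.re hrel
      rwa [re_intCast_mul, Complex.re_sum, re_modularSymbol_depleted_eq_real W hf l hl L hNL g hg 0] at h
    have hsumR : (u : ℝ) * (2 * ((∏ ℓ ∈ SS, ℓ ^ 2 : ℕ) : ℝ) * ((eulerDepleteTableList W l (ratPlusSymbol f) 0 : ℚ) : ℝ)) =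
        ∑ j, (zs j : ℝ) := by
      calc (u : ℝ) * (2 * ((∏ ℓ ∈ SS, ℓ ^ 2 : ℕ) : ℝ) * ((eulerDepleteTableList W l (ratPlusSymbol f) 0 : ℚ) : ℝ))
          = (2 * ((∏ ℓ ∈ SS, ℓ ^ 2 : ℕ) : ℝ) / plusPeriod f) *
              ((u : ℝ) * (plusPeriod f * ((eulerDepleteTableList W l (ratPlusSymbol f) 0 : ℚ) : ℝ))) := by
            field_simp
        _ = (2 * ((∏ ℓ ∈ SS, ℓ ^ 2 : ℕ) : ℝ) / plusPeriod f) * ∑ j, (cuspSymbol g (γs j)).re := by rw [hre]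
        _ = ∑ j, (2 * ((∏ ℓ ∈ SS, ℓ ^ 2 : ℕ) : ℝ) / plusPeriod f) * (cuspSymbol g (γs j)).re := Finset.mul_sum _ _ _
        _ = ∑ j, (zs j : ℝ) := Finset.sum_congr rfl fun j _ ↦ by rw [← hzs j, periodFunctional_apply]
    have hsumQ : (u : ℚ) * (2 * ((∏ ℓ ∈ SS, ℓ ^ 2 : ℕ) : ℚ) * eulerDepleteTableList W l (ratPlusSymbol f) 0) =
        ((∑ j, zs j : ℤ) : ℚ) := by
      have h : ((∑ j, zs j : ℤ) : ℝ) = ∑ j, (zs j : ℝ) := by push_cast; rfl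
      rw [← h] at hsumR
      exact_mod_cast hsumR
    -- `u` is odd, so the left-hand side has norm `> 1/2`: the sum is odd
    have huodd : Odd u := by
      rw [hu, LFunction_apply_prime_eq_frobeniusTrace W q hgoodq, ← Int.not_even_iff_odd, even_iff_two_dvd,
        show W.frobeniusTrace q - q - 1 = W.frobeniusTrace q - (q + 1) by ring]
      exact hodd
    -- an odd integer is a `2`-adic unit (`DepletionAtTwo.norm_intCast_eq_one_of_odd`, not imported here)
    have hunorm : ‖(u : ℚ_[2])‖ = 1 := by
      refine le_antisymm (Padic.norm_int_le_one _) (not_lt.mp fun hlt ↦ ?_)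
      rw [Padic.norm_intCast_lt_one_iff] at hlt
      exact (Int.not_even_iff_odd.mpr huodd) (even_iff_two_dvd.mpr (by exact_mod_cast hlt))
    have hsumodd : Odd (∑ j, zs j) := by
      apply odd_of_half_lt_norm
      have hcast : ((∑ j, zs j : ℤ) : ℚ_[2]) = (((∑ j, zs j : ℤ) : ℚ) : ℚ_[2]) := by norm_cast
      rw [hcast, ← hsumQ, Rat.cast_mul, norm_mul, h2D, Rat.cast_intCast, hunorm, one_mul]
      linarith [hcase]
    -- some summand is odd
    by_contra hnone
    push Not at hnone
    have hall : ∀ j ∈ (Finset.univ : Finset (Fin q)), Even (zs j) := fun j _ ↦ by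
      rcases Int.even_or_odd (zs j) with h | h
      · exact h
      · exact absurd h (hnone (γs j) (zs j) (hzs j))
    exact (Int.not_even_iff_odd.mpr hsumodd) (Finset.even_sum (s := Finset.univ) (f := zs) hall)

end Odd

end Summit.BirchSwinnertonDyer.BirchSwinnertonDyer.Theorems.AlignedTransportAtTwoOrdPlusLineOdd

end
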